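import Literature.NumberTheory.EllipticCurves.KrizLi2019.TwoPartBSDTwists
import Literature.NumberTheory.EllipticCurves.Rank1Residual.X11RankOneCertificates.Minimality
import Literature.NumberTheory.EllipticCurves.ComplexMultiplicationHasCMProofs
import HarnessLib

/-!
# Kriz–Li 2019 (FMS 7, e15), §6 Table 1 — the row `243a1` AS PRINTED: for `E = 243a1` and
# `K = ℚ(√−23)`, Assumption (★) holds (statement-only named fact; the per-curve input of Thm 5.1 (2)
# = `thm112_bsdTwo_twist` at the only CM base curve of the authors' table)

HONEST FRAMING (cell `bsd-print-cf2`, D-0131 (2) PRINT TIER, leaf CornerF @ `p = 2`, slice INERT-GOOD;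
lit seat g2, 2026-08-27): a PUBLISHED per-curve computational assertion (a check-mark in a table of a
refereed paper) vendored as a named `Prop` — nothing asserted, nothing discharged (D-0014) — with a
locator into the held source, plus the kernel facts about the model that ARE decidable (`Δ`, `c₄`,
ellipticity, global minimality, `j = 0`, CM). It is the only non-kernel, non-theorem input of the
Kriz–Li road on the `243a1`-family of the leaf (`{243a1^{(d)} : d ∈ 𝒩(243a1, ℚ(√−23))}`, every member CM
with `j = 0`, analytic rank one, `2 ∤ N = 243 d²`): Assumption (★) is a statement about the `2`-adic
formal logarithm of the Heegner point, which the kernel cannot evaluate. Nothing is booked here; the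
consumer (a Summits file) displays `thm112_bsdTwo_twist`, Miller's `bsdp_of_irreducible_of_conductor_lt`
(or bsd.S31) for `BSD(243a1, 2)`, Burungale–Flach for the rank-zero partner `243a1^{(−23)}`, and this row.

Source. D. Kriz, C. Li, *Goldfeld's conjecture and congruences between Heegner points*, Forum Math.
Sigma **7** (2019), e15, doi:10.1017/fms.2019.9 [KrizLi2019] = arXiv:1606.03172 (§§1–6). Texts read:
the held chunk texts `paper:doi-10-1017-fms-2019-9` (p0017 L21: Example 6.2, Remark 6.3) and
`paper:arxiv-1606.03172` (p0019 L41–L44), which both DROP the table body; the table itself was read in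
the arXiv **v3** e-print source `Congruence.tex` (tar dated 2017-11-27; copy kept by the cell at
`run/shared/lean/pub/bsd-print-cf2/lit/krizli2019/arXiv-1606.03172v3-Congruence.tex`), lines 967–1017
(`\label{tab:1}`), row at line 1011.

## The printed statement (verbatim)

* Example 6.2 (tex l. 965; FMS p0017 L21): "We search for rank one optimal elliptic curves with
  `E(ℚ)[2] = 0` satisfying these two necessary conditions. There are 38 such curves of conductor `≤ 300`.
  For each curve, we choose `K` with smallest `|d_K|` satisfying the Heegner hypothesis for `N` and such
  that `2` is split in `K`. Then 31 out of 38 curves satisfy (★). See Table 1. The first three columns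
  list `E`, `d_K` and the local Tamagawa number `c₂(E)` at `2` respectively. A check-mark in the last
  column means that (★) holds, in which case Theorems 4.3, 1.12 apply … If `c₂(E)` is further odd (true
  for 23 out of 31), then the application to BSD(2) (Theorem 5.1) also applies."
* Table 1, caption "Assumption (★) for rank one curves", header `E | d_K | c₂(E) | ★`, row (tex l. 1011):
  "`243a1 & -23 & 1 & \checkmark`".
* Remark 6.3 (tex l. 1021; FMS p0017 L21): "There is one CM elliptic curve in Table 1: namely `E = 243a1`
  with `j`-invariant `0`, which seems to be only `j`-invariant of CM elliptic curves over `ℚ` for which (★)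
  holds."
* (★) itself (Thm 1.4 / Thm 4.3, tex l. 306 and l. 762): "`2` splits in `K` and
  `|Ẽ^{ns}(𝔽₂)| · log_{ω_E}(P) / 2 ≢ 0 (mod 2)`", `P ∈ E(K)` the Heegner point of the fixed modular
  parametrisation `π_E : X₀(N) → E`, `ω_E` with `π_E^* ω_E = f(q) dq/q` (§1, arXiv p0003 L30–L38).

## Transcription (tree dictionary of `KrizLi2019/TwoPartBSDTwists.lean`, binders of `thm112_bsdTwo_twist`)

`E = 243a1` = Cremona's globally minimal model `[0, 0, 1, 0, −1]` (`y² + y = x³ − 1`; `Δ = −243 = −3⁵`,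
`c₄ = 0`, `j = 0`, conductor `243`), here `curve243a1`; "`K = ℚ(√−23)`" = any number field `K` with
`IsImaginaryQuadratic K` and `NumberField.discr K = −23`; "(★) holds for the Heegner point of a modular
parametrisation" = there are a parametrisation datum `Dt : ModularParametrizationData curve243a1 N`
(`N = conductorNorm`, with its `NeZero` witness packed as in `ShuZhai2021.table52_row36a1`), a Heegner
datum `H : HeegnerDatum N (discr K)`, an embedding `ι : K →+* ℂ`, a point `P ∈ E(K)` mapping to
`heegnerPointComplex Dt H`, and an embedding `j : K →ₐ[ℚ] ℚ₂` with `AssumptionStar curve243a1 Dt K P j`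
— exactly the binders `Dt, H, ι, P, (P ↦ heegnerPointComplex), j, AssumptionStar` of
`thm112_bsdTwo_twist`, so that the consumer instantiates that theorem at `W = curve243a1` with no
further gloss. The other printed columns are kernel-side and NOT transcribed into the fact: "rank one"
(not needed by Thm 5.1 (2)), "`E(ℚ)[2] = 0`" (`4x³ − 3` has no rational root), "`c₂(E) = 1`" (good
reduction at `2`), "optimal" (void for Thm 5.1 (2) at a prime of good reduction; Manin constant `1` by
Cremona is the tree's `AgasheRibetStein2006` fact if ever wanted). Nothing weaker or stronger is
transcribed; no `_holds` is expected (it needs the `2`-adic logarithm of an explicit Heegner point).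
Status: PUB (refereed); a per-curve computational TABLE entry, flag word for the referee: TABLE.
Independent numerical reproduction (not part of the fact; cell file
`pub/bsd-print-cf2/lit/census-g2/j282381-stdout.txt`, SageMath 10.9): the Heegner point for `D = −23`
is the generator `P₀ = (1, 0)` of `E(ℚ) ≅ ℤ` (Heegner index `1`), `|Ẽ(𝔽₂)| = 3`, and
`v₂(3 · log_ω P₀) = 1`, i.e. `(3 · log_ω P)/2 ∈ ℤ₂ˣ`.

## References
* [KrizLi2019] §6 Example 6.2, Table 1 (row 243a1), Remark 6.3 (FMS chunk p0017 L21; arXiv:1606.03172v3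
  `Congruence.tex` ll. 965, 967–1017 (row l. 1011), 1021); Assumption (★) tex l. 306 / l. 762.
* [Cremona1997] Table 1 (curve 243a1 = `[0,0,1,0,−1]`, the `Γ₀(243)`-optimal curve of its class).
* [SilvermanAEC2009] VII.1 Remark 1.1 (minimality criterion `ord_p Δ < 12`), Appendix C §11 (`j = 0` is CM).
-/

noncomputable section

open scoped Classical

open NumberField WeierstrassCurve Literature.NumberTheory.EllipticCurves
  Literature.NumberTheory.EllipticCurves.ModularForms
  Literature.NumberTheory.EllipticCurves.Rank1Residual.X11RankOneCertificates

namespace Literature.NumberTheory.EllipticCurves.KrizLi2019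

/-! ### The curve `243a1` (kernel facts about the model) -/

/-- **Cremona's `243a1`**: `y² + y = x³ − 1`, a-invariants `[0, 0, 1, 0, −1]`; conductor `243 = 3⁵`,
`Δ = −243`, `j = 0` (CM by `ℤ[ζ₃]`), `E(ℚ) ≅ ℤ` generated by `(1, 0)`, `E(ℚ)_tors = 0`.
[cite: Cremona1997, Table 1 (curve 243a1)] -/
def curve243a1 : WeierstrassCurve ℚ := ⟨0, 0, 1, 0, -1⟩

/-- `Δ(243a1) = −243 = −3⁵`. [cite: Cremona1997, Table 1 (curve 243a1)] -/
theorem curve243a1_Δ : curve243a1.Δ = -243 := by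
  simp only [curve243a1, WeierstrassCurve.Δ, WeierstrassCurve.b₂, WeierstrassCurve.b₄,
    WeierstrassCurve.b₆, WeierstrassCurve.b₈]
  norm_num

/-- `c₄(243a1) = 0` (so `j = 0`). [cite: Cremona1997, Table 1 (curve 243a1)] -/
theorem curve243a1_c₄ : curve243a1.c₄ = 0 := by
  simp only [curve243a1, WeierstrassCurve.c₄, WeierstrassCurve.b₂, WeierstrassCurve.b₄]
  norm_num

/-- `243a1` is an elliptic curve (`Δ = −243 ≠ 0`). A theorem, not an instance (statement-file rule);
consumers write `haveI := isElliptic_curve243a1`. [cite: Cremona1997, Table 1 (curve 243a1)] -/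
theorem isElliptic_curve243a1 : curve243a1.IsElliptic :=
  ⟨by rw [curve243a1_Δ]; exact isUnit_iff_ne_zero.mpr (by norm_num)⟩

/-- The model `[0, 0, 1, 0, −1]` is the integer model cast to `ℚ` (for the minimality criterion).
[cite: Cremona1997, Table 1 (curve 243a1)] -/
theorem curve243a1_eq_intCast :
    curve243a1 = (⟨((0 : ℤ) : ℚ), ((0 : ℤ) : ℚ), ((1 : ℤ) : ℚ), ((0 : ℤ) : ℚ), ((-1 : ℤ) : ℚ)⟩ :
      WeierstrassCurve ℚ) := by
  ext <;> simp [curve243a1]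

/-- **`[0, 0, 1, 0, −1]` is a global minimal model** (`|Δ| = 3⁵`: no prime `q` with `q¹² ∣ Δ`;
Silverman's criterion `ord_q Δ < 12` at every prime, tree `isGloballyMinimal_of_int_criterion`).
A theorem, not an instance; consumers write `haveI := isGloballyMinimal_curve243a1`.
[cite: SilvermanAEC2009, VII.1 Remark 1.1] -/
theorem isGloballyMinimal_curve243a1 : curve243a1.IsGloballyMinimal := by
  rw [curve243a1_eq_intCast]
  refine isGloballyMinimal_of_int_criterion 0 0 1 0 (-1) fun q hq hboth => ?_
  have hΔ : discOf [0, 0, 1, 0, -1] = -243 := by decide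
  have h12 : (q : ℤ) ^ 12 ∣ 243 := by
    have h := hboth.1
    rw [hΔ] at h
    exact Int.dvd_neg.mp h
  have h12' : q ^ 12 ∣ 243 := by exact_mod_cast h12
  have hle : q ^ 12 ≤ 243 := Nat.le_of_dvd (by norm_num) h12'
  have hpow : 2 ^ 12 ≤ q ^ 12 := Nat.pow_le_pow_left hq.two_le 12
  omega

/-- `j(243a1) = 0`. [cite: Cremona1997, Table 1 (curve 243a1)] -/
theorem curve243a1_j : (haveI := isElliptic_curve243a1; curve243a1.j) = 0 :=
  haveI := isElliptic_curve243a1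
  WeierstrassCurve.j_eq_zero (W := curve243a1) (h := curve243a1_c₄)

/-- **`243a1` has complex multiplication** (`j = 0`: CM by `ℤ[ζ₃]`; tree `hasCM_of_j_eq_zero`).
[cite: SilvermanAEC2009, Appendix C §11, Example 11.3.1] -/
theorem hasCM_curve243a1 : curve243a1.HasCM :=
  haveI := isElliptic_curve243a1
  hasCM_of_j_eq_zero _ curve243a1_j

/-! ### The table row (statement-only named fact) -/

/-- **Kriz–Li 2019, §6 Table 1, row `243a1`** (verbatim in the module docstring: `243a1 | d_K = −23 |
c₂(E) = 1 | ★ ✓`; Example 6.2; Remark 6.3 "There is one CM elliptic curve in Table 1: namely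
`E = 243a1` with `j`-invariant `0`"): for every imaginary quadratic field `K` of discriminant `−23`, the
curve `243a1` on its global minimal model `[0,0,1,0,−1]` admits a modular parametrisation datum `Dt` at
level `N(E)`, a Heegner datum `H` of discriminant `d_K` and level `N(E)`, an embedding `ι : K → ℂ`, a point
`P ∈ E(K)` mapping to the Heegner point `heegnerPointComplex Dt H`, and an embedding `j : K → ℚ₂`, such
that Assumption (★) `AssumptionStar curve243a1 Dt K P j` holds — i.e. exactly the hypotheses
`Dt, H, ι, P, hP, j, (★)` of `thm112_bsdTwo_twist` at `W = curve243a1`. Statement only; TABLE entry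
(a `2`-adic logarithm computation) in a refereed paper; no `_holds` expected.
[cite: KrizLi2019, §6 Table 1 (row 243a1), Example 6.2 and Remark 6.3 (FMS 7 (2019) e15, chunk p0017 L21; arXiv:1606.03172v3 Congruence.tex ll. 965, 1011, 1021)] -/
def table1_row243a1 : Prop :=
  letI : curve243a1.IsGloballyMinimal := isGloballyMinimal_curve243a1
  ∀ (K : Type) [Field K] [NumberField K], IsImaginaryQuadratic K → NumberField.discr K = -23 →
    ∃ (_ : NeZero (curve243a1.conductorNorm ℤ))
      (Dt : ModularParametrizationData curve243a1 (curve243a1.conductorNorm ℤ))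
      (H : HeegnerDatum (curve243a1.conductorNorm ℤ) (NumberField.discr K)) (ι : K →+* ℂ)
      (P : (curve243a1.baseChange K).toAffine.Point) (j : K →ₐ[ℚ] ℚ_[2]),
      WeierstrassCurve.Affine.Point.map ι.toRatAlgHom P = heegnerPointComplex Dt H ∧
        AssumptionStar curve243a1 Dt K P j

end Literature.NumberTheory.EllipticCurves.KrizLi2019

end
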